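import Summits.CriticalPhenomena.PercolationContinuityZ3.Theorems.PercNearOneGluingNoHeavyLowerTailGZSPDefs
import Summits.CriticalPhenomena.PercolationContinuityZ3.Theorems.PercNearOneGluingNoHeavyLowerTailGZHubStep
import Summits.CriticalPhenomena.PercolationContinuityZ3.Theorems.PercNearOneGluingNoHeavyLowerTailGZSeriesStep
import HarnessLib

/-!
# `NoHeavyLowerTail` (stmt-CriticalPhenomena-4575) — support file: **THEOREM SP** — the logarithmic covariance bound
# `Cov(1{a ↔ c}, 1{b ↔ c}) ≤ P(ab|c)·log(P(a ↔ b off c)/P(ab|c))` on every two-terminal series–parallel hub network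
# (prover `prim-ineq-prove-2` gen 12; memo `run/shared/lean/prim/prim-ineq-prove-2/THEOREM-SP.md`)

No definitions, no named facts, no sorries.  Setting: a finite vertex type `V`, independent edges (`prodBernoulli w` on
`Set (Sym2 V)`), three distinct vertices `a, b` (terminals) and `c` (the hub), and an edge set `E` which is a two-terminal
series–parallel hub network `GZSP.IsSPNet c E a b` (Defs file `…GZSPDefs`): built from single edges `ab` by attaching hub
edges `ac` / `bc` at terminals and by series / parallel composition.  Events are read on `ω ∩ E`:
`Aᶜ = {a ↮ c}`, `Bᶜ = {b ↮ c}`, `D = {a ↮ b}`, `T = {a ↔ b off c}` (pairs at `c` removed); `z = P(Aᶜ ∩ Bᶜ)`,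
`n = P(D ∩ Aᶜ ∩ Bᶜ) = P(a|b|c)`, `w = z − n = P(ab|c)`, `θ = P(T) = P(a ↔ b off c)`, and
`Cov(1{a ↔ c}, 1{b ↔ c}) = P(Aᶜ ∩ Bᶜ) − P(Aᶜ)P(Bᶜ)`.

* `GZSP.IsSPNet.terminals_ne`, `left_mem`, `right_mem` — bookkeeping invariants of the syntax;
* `GZSP.sp_facts` — by induction over the syntax: the bound together with non-degeneracy `0 < n < z`, for all weights
  `0 < w(e) < 1` on `E` (steps: `GZHubStep.edge_facts`, `GZHubStep.hub_left_facts` / `hub_right_facts`,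
  `GZSeriesStep.series_cov_le` + `GZSeriesLaw.series_law_z/n`, `GZGluingLaw.parallel_cov_le` + `parallel_law`);
* `GZSP.sp_cov_le` — **THEOREM SP**: `P(a↮c, b↮c) − P(a↮c)·P(b↮c) ≤ P(ab|c) · log (P(a ↔ b off c) / P(ab|c))` for every
  two-terminal series–parallel hub network with weights in `(0, 1)`.  Since `Cov(1{a↔c},1{b↔c}) = P(a↮c,b↮c) −
  P(a↮c)P(b↮c)` and `P(a ↔ b off c) ≤ 1`, this is Gladkov–Zimin Conj. 6.3 / Gladkov Conj. 10.1 with the explicit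
  modulus `ε = δ log(1/δ)` on this class, uniformly in the hub geometry (the hub may be joined to any set of vertices of
  the network with any weights).  First core not covered: the Wheatstone bridge;
* `GZSP.sp_cov_le_mul_log_inv` — the same in the printed shape `P(a↔c, b↔c) − P(a↔c)P(b↔c) ≤ P(ab|c)·log(1/P(ab|c))`
  (`GZSP.cov_compl_eq`: covariance is unchanged under complementing both events; `P(a ↔ b off c) ≤ 1`).
-/

noncomputable section

namespace Summit.CriticalPhenomena.PercolationContinuityZ3.Theorems

open MeasureTheory Literature.Probability.LatticeModels Literature.Probability.Percolation
open scoped Classical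

namespace GZSP

variable {V : Type*}

/-- Both terminals of a series–parallel hub network are covered by its edges. [folklore] -/
theorem IsSPNet.terminals_mem {c : V} {E : Finset (Sym2 V)} {a b : V} (h : IsSPNet c E a b) :
    (∃ e ∈ E, a ∈ e) ∧ (∃ e ∈ E, b ∈ e) := by
  induction h with
  | @edge a b _ _ _ =>
    exact ⟨⟨s(a, b), Finset.mem_singleton_self _, Sym2.mem_mk_left a b⟩,
      ⟨s(a, b), Finset.mem_singleton_self _, Sym2.mem_mk_right a b⟩⟩
  | hubLeft _ _ ih =>
    obtain ⟨⟨e, he, hae⟩, ⟨f, hf, hbf⟩⟩ := ih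
    exact ⟨⟨e, Finset.mem_insert_of_mem he, hae⟩, ⟨f, Finset.mem_insert_of_mem hf, hbf⟩⟩
  | hubRight _ _ ih =>
    obtain ⟨⟨e, he, hae⟩, ⟨f, hf, hbf⟩⟩ := ih
    exact ⟨⟨e, Finset.mem_insert_of_mem he, hae⟩, ⟨f, Finset.mem_insert_of_mem hf, hbf⟩⟩
  | series _ _ _ _ _ _ ih₁ ih₂ =>
    obtain ⟨⟨e, he, hae⟩, -⟩ := ih₁
    obtain ⟨-, ⟨f, hf, hbf⟩⟩ := ih₂
    exact ⟨⟨e, Finset.mem_union_left _ he, hae⟩, ⟨f, Finset.mem_union_right _ hf, hbf⟩⟩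
  | parallel _ _ _ _ ih₁ _ =>
    obtain ⟨⟨e, he, hae⟩, ⟨f, hf, hbf⟩⟩ := ih₁
    exact ⟨⟨e, Finset.mem_union_left _ he, hae⟩, ⟨f, Finset.mem_union_left _ hf, hbf⟩⟩

/-- The terminals and the hub of a series–parallel hub network are pairwise distinct. [folklore] -/
theorem IsSPNet.terminals_ne {c : V} {E : Finset (Sym2 V)} {a b : V} (h : IsSPNet c E a b) :
    a ≠ b ∧ a ≠ c ∧ b ≠ c := by
  induction h with
  | edge hab hac hbc => exact ⟨hab, hac, hbc⟩
  | hubLeft _ _ ih => exact ih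
  | hubRight _ _ ih => exact ih
  | series _ h₂ _ _ ha _ ih₁ ih₂ =>
    refine ⟨?_, ih₁.2.1, ih₂.2.2⟩
    rintro rfl
    obtain ⟨-, ⟨f, hf, hbf⟩⟩ := h₂.terminals_mem
    exact ha f hf hbf
  | parallel _ _ _ _ ih₁ _ => exact ih₁

/-- Non-degeneracy arithmetic of the series step: `n = ā₁ b̄₂ + n₁ w₂ + w₁ n₂ > 0` and `z − n = w₁ w₂ > 0`. [folklore] -/
theorem series_nondeg_of_facts {z n a₁ n₁ u₁ z₁ bb₂ n₂ v₂ z₂ : ℝ}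
    (sz : z = a₁ * bb₂ + n₁ * (v₂ - bb₂) + (u₁ - a₁) * n₂ + (u₁ - a₁) * (v₂ - bb₂))
    (sn : n = z - (z₁ - n₁) * (z₂ - n₂)) (f1u : u₁ = z₁ + a₁ - n₁) (f2v : v₂ = z₂ + bb₂ - n₂)
    (ha₁ : 0 ≤ a₁) (hb₂ : 0 ≤ bb₂) (hn₁ : 0 < n₁) (hn₂ : 0 < n₂) (hw₁ : n₁ < z₁) (hw₂ : n₂ < z₂) :
    0 < n ∧ n < z := by
  have e₁ : u₁ - a₁ = z₁ - n₁ := by linarith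
  have e₂ : v₂ - bb₂ = z₂ - n₂ := by linarith
  rw [e₁, e₂] at sz
  have hw₁' : 0 < z₁ - n₁ := by linarith
  have hw₂' : 0 < z₂ - n₂ := by linarith
  constructor
  · rw [sn, sz]; nlinarith [mul_nonneg ha₁ hb₂, mul_pos hn₁ hw₂', mul_pos hw₁' hn₂]
  · rw [sn]; nlinarith [mul_pos hw₁' hw₂']

/-- Non-degeneracy arithmetic of the parallel step: `n = n₁ n₂ > 0` and `z = z₁ z₂ > n`. [folklore] -/
theorem parallel_nondeg_of_facts {z n z₁ n₁ z₂ n₂ : ℝ} (pz : z = z₁ * z₂) (pn : n = n₁ * n₂)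
    (hn₁ : 0 < n₁) (hnz₁ : n₁ < z₁) (hn₂ : 0 < n₂) (hnz₂ : n₂ < z₂) : 0 < n ∧ n < z := by
  constructor
  · rw [pn]; positivity
  · rw [pn, pz]; nlinarith [mul_pos hn₁ hn₂]

variable [Fintype V]

/-- **THEOREM SP with non-degeneracy** (induction over the series–parallel syntax): for a two-terminal series–parallel
hub network `E` with terminals `a, b`, hub `c` and weights `0 < w(e) < 1` on `E`, the logarithmic covariance bound holds
and `0 < P(a|b|c) < P(a ↮ c, b ↮ c)`.  Base `GZHubStep.edge_facts`; steps `GZHubStep.hub_left_facts` /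
`hub_right_facts`, `GZSeriesStep.series_cov_le`, `GZGluingLaw.parallel_cov_le`. [folklore] -/
theorem sp_facts (w : Sym2 V → unitInterval) {c : V} {E : Finset (Sym2 V)} {a b : V} (h : IsSPNet c E a b)
    (hw : ∀ e ∈ E, 0 < (w e : ℝ) ∧ (w e : ℝ) < 1) :
    ((prodBernoulli w).real ({ω : Set (Sym2 V) | ¬(openGraph (ω ∩ (↑E : Set (Sym2 V)))).Reachable a c} ∩ {ω : Set (Sym2 V) | ¬(openGraph (ω ∩ (↑E : Set (Sym2 V)))).Reachable b c}) -
        (prodBernoulli w).real {ω : Set (Sym2 V) | ¬(openGraph (ω ∩ (↑E : Set (Sym2 V)))).Reachable a c} *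
          (prodBernoulli w).real {ω : Set (Sym2 V) | ¬(openGraph (ω ∩ (↑E : Set (Sym2 V)))).Reachable b c} ≤
      ((prodBernoulli w).real ({ω : Set (Sym2 V) | ¬(openGraph (ω ∩ (↑E : Set (Sym2 V)))).Reachable a c} ∩ {ω : Set (Sym2 V) | ¬(openGraph (ω ∩ (↑E : Set (Sym2 V)))).Reachable b c}) -
          (prodBernoulli w).real ({ω : Set (Sym2 V) | ¬(openGraph (ω ∩ (↑E : Set (Sym2 V)))).Reachable a b} ∩ {ω : Set (Sym2 V) | ¬(openGraph (ω ∩ (↑E : Set (Sym2 V)))).Reachable a c} ∩ {ω : Set (Sym2 V) | ¬(openGraph (ω ∩ (↑E : Set (Sym2 V)))).Reachable b c})) *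
        Real.log ((prodBernoulli w).real {ω : Set (Sym2 V) | (openGraph ((ω ∩ (↑E : Set (Sym2 V))) \ {e : Sym2 V | c ∈ e})).Reachable a b} /
          ((prodBernoulli w).real ({ω : Set (Sym2 V) | ¬(openGraph (ω ∩ (↑E : Set (Sym2 V)))).Reachable a c} ∩ {ω : Set (Sym2 V) | ¬(openGraph (ω ∩ (↑E : Set (Sym2 V)))).Reachable b c}) -
            (prodBernoulli w).real ({ω : Set (Sym2 V) | ¬(openGraph (ω ∩ (↑E : Set (Sym2 V)))).Reachable a b} ∩ {ω : Set (Sym2 V) | ¬(openGraph (ω ∩ (↑E : Set (Sym2 V)))).Reachable a c} ∩ {ω : Set (Sym2 V) | ¬(openGraph (ω ∩ (↑E : Set (Sym2 V)))).Reachable b c})))) ∧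
    0 < (prodBernoulli w).real ({ω : Set (Sym2 V) | ¬(openGraph (ω ∩ (↑E : Set (Sym2 V)))).Reachable a b} ∩ {ω : Set (Sym2 V) | ¬(openGraph (ω ∩ (↑E : Set (Sym2 V)))).Reachable a c} ∩ {ω : Set (Sym2 V) | ¬(openGraph (ω ∩ (↑E : Set (Sym2 V)))).Reachable b c}) ∧
    (prodBernoulli w).real ({ω : Set (Sym2 V) | ¬(openGraph (ω ∩ (↑E : Set (Sym2 V)))).Reachable a b} ∩ {ω : Set (Sym2 V) | ¬(openGraph (ω ∩ (↑E : Set (Sym2 V)))).Reachable a c} ∩ {ω : Set (Sym2 V) | ¬(openGraph (ω ∩ (↑E : Set (Sym2 V)))).Reachable b c}) <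
      (prodBernoulli w).real ({ω : Set (Sym2 V) | ¬(openGraph (ω ∩ (↑E : Set (Sym2 V)))).Reachable a c} ∩ {ω : Set (Sym2 V) | ¬(openGraph (ω ∩ (↑E : Set (Sym2 V)))).Reachable b c}) := by
  induction h with
  | @edge a b hab hac hbc =>
    have hr := hw s(a, b) (Finset.mem_singleton_self _)
    exact GZHubStep.edge_facts w hab hac hbc hr.1 hr.2 rfl rfl rfl rfl
  | @hubLeft E a b h he ih =>
    obtain ⟨hab, hac, hbc⟩ := h.terminals_ne
    obtain ⟨L, hn, hnz⟩ := ih fun e he' => hw e (Finset.mem_insert_of_mem he')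
    exact GZHubStep.hub_left_facts w hab hac hbc he (hw _ (Finset.mem_insert_self _ _)).2
      rfl rfl rfl rfl rfl rfl rfl rfl hn hnz L
  | @hubRight E a b h he ih =>
    obtain ⟨hab, hac, hbc⟩ := h.terminals_ne
    obtain ⟨L, hn, hnz⟩ := ih fun e he' => hw e (Finset.mem_insert_of_mem he')
    exact GZHubStep.hub_right_facts w hab hac hbc he (hw _ (Finset.mem_insert_self _ _)).2
      rfl rfl rfl rfl rfl rfl rfl rfl hn hnz L
  | @series E₁ E₂ a m b h₁ h₂ hd hS ha hb ih₁ ih₂ =>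
    obtain ⟨ham, hac, hmc⟩ := h₁.terminals_ne
    obtain ⟨hmb, -, hbc⟩ := h₂.terminals_ne
    have hab : a ≠ b := by
      rintro rfl
      obtain ⟨-, ⟨f, hf, hbf⟩⟩ := h₂.terminals_mem
      exact ha f hf hbf
    obtain ⟨L₁, hn₁, hnz₁⟩ := ih₁ fun e he => hw e (Finset.mem_union_left _ he)
    obtain ⟨L₂, hn₂, hnz₂⟩ := ih₂ fun e he => hw e (Finset.mem_union_right _ he)
    have k₁ : ∀ e ∈ (↑E₁ : Set (Sym2 V)), ∀ z ∈ e, z ∈ {z : V | ∃ e ∈ E₁, z ∈ e} := fun e he z hz => ⟨e, he, hz⟩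
    have k₂ : ∀ e ∈ (↑E₂ : Set (Sym2 V)), ∀ z ∈ e, z ∈ {z : V | ∃ e ∈ E₂, z ∈ e} := fun e he z hz => ⟨e, he, hz⟩
    have kS : {z : V | ∃ e ∈ E₁, z ∈ e} ∩ {z : V | ∃ e ∈ E₂, z ∈ e} ⊆ {m, c} := by
      rintro z ⟨hz₁, hz₂⟩
      rcases hS z hz₁ hz₂ with rfl | rfl
      · exact Set.mem_insert _ _
      · exact Set.mem_insert_of_mem _ rfl
    have kaV₂ : a ∉ {z : V | ∃ e ∈ E₂, z ∈ e} := fun ⟨e, he, hae⟩ => ha e he hae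
    have kbV₁ : b ∉ {z : V | ∃ e ∈ E₁, z ∈ e} := fun ⟨e, he, hbe⟩ => hb e he hbe
    have key := GZSeriesStep.series_cov_le w k₁ k₂ kS kaV₂ kbV₁ ham hac hab hmb.symm hbc hmc hd hnz₁ hnz₂ L₁ L₂
    have sz := GZSeriesLaw.series_law_z w k₁ k₂ kS kaV₂ kbV₁ ham hac hab hmb.symm hbc hmc hd
    have sn := GZSeriesLaw.series_law_n w k₁ k₂ kS kaV₂ kbV₁ ham hac hab hmb.symm hbc hmc hd
    obtain ⟨f1u, -, -, -, -, -, -, -, -⟩ :=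
      GZGluingLaw.network_facts w (↑E₁ : Set (Sym2 V)) (a := a) (b := m) hac rfl rfl rfl rfl
    obtain ⟨-, f2v, -, -, -, -, -, -, -⟩ :=
      GZGluingLaw.network_facts w (↑E₂ : Set (Sym2 V)) (a := m) (b := b) hmc rfl rfl rfl rfl
    have nd := series_nondeg_of_facts sz sn f1u f2v measureReal_nonneg measureReal_nonneg hn₁ hn₂ hnz₁ hnz₂
    simp only [Finset.coe_union]
    exact ⟨key, nd.1, nd.2⟩
  | @parallel E₁ E₂ a b h₁ h₂ hd hS ih₁ ih₂ =>
    obtain ⟨hab, hac, hbc⟩ := h₁.terminals_ne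
    obtain ⟨L₁, hn₁, hnz₁⟩ := ih₁ fun e he => hw e (Finset.mem_union_left _ he)
    obtain ⟨L₂, hn₂, hnz₂⟩ := ih₂ fun e he => hw e (Finset.mem_union_right _ he)
    have k₁ : ∀ e ∈ (↑E₁ : Set (Sym2 V)), ∀ z ∈ e, z ∈ {z : V | ∃ e ∈ E₁, z ∈ e} := fun e he z hz => ⟨e, he, hz⟩
    have k₂ : ∀ e ∈ (↑E₂ : Set (Sym2 V)), ∀ z ∈ e, z ∈ {z : V | ∃ e ∈ E₂, z ∈ e} := fun e he z hz => ⟨e, he, hz⟩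
    have kS : {z : V | ∃ e ∈ E₁, z ∈ e} ∩ {z : V | ∃ e ∈ E₂, z ∈ e} ⊆ {a, b, c} := by
      rintro z ⟨hz₁, hz₂⟩
      rcases hS z hz₁ hz₂ with rfl | rfl | rfl
      · exact Set.mem_insert _ _
      · exact Set.mem_insert_of_mem _ (Set.mem_insert _ _)
      · exact Set.mem_insert_of_mem _ (Set.mem_insert_of_mem _ rfl)
    have key := GZGluingLaw.parallel_cov_le w k₁ k₂ kS hd hab hac hbc hn₁ hn₂ hnz₁ hnz₂ L₁ L₂
    obtain ⟨pz, -, -, pn, -⟩ := GZGluingLaw.parallel_law w k₁ k₂ kS hd hab hac hbc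
    have nd := parallel_nondeg_of_facts pz pn hn₁ hnz₁ hn₂ hnz₂
    simp only [Finset.coe_union]
    exact ⟨key, nd.1, nd.2⟩

/-- **THEOREM SP** (Gladkov–Zimin Conj. 6.3 / Gladkov Conj. 10.1 on the series–parallel class, with modulus
`w log (1/w)`): for a finite graph with independent edge weights `0 < w(e) < 1` whose edge set `E` is a two-terminal
series–parallel hub network with terminals `a, b` and hub `c` (the hub joined to any of its vertices),
`P(a ↮ c, b ↮ c) − P(a ↮ c)·P(b ↮ c) ≤ P(ab|c) · log (P(a ↔ b off c) / P(ab|c))`, i.e.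
`Cov(1{a ↔ c}, 1{b ↔ c}) ≤ P(ab|c) log(P(a ↔_{G−c} b)/P(ab|c)) ≤ P(ab|c) log(1/P(ab|c))`.
[folklore; this work — memo THEOREM-SP.md] -/
theorem sp_cov_le (w : Sym2 V → unitInterval) {c : V} {E : Finset (Sym2 V)} {a b : V} (h : IsSPNet c E a b)
    (hw : ∀ e ∈ E, 0 < (w e : ℝ) ∧ (w e : ℝ) < 1) :
    (prodBernoulli w).real ({ω : Set (Sym2 V) | ¬(openGraph (ω ∩ (↑E : Set (Sym2 V)))).Reachable a c} ∩ {ω : Set (Sym2 V) | ¬(openGraph (ω ∩ (↑E : Set (Sym2 V)))).Reachable b c}) -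
        (prodBernoulli w).real {ω : Set (Sym2 V) | ¬(openGraph (ω ∩ (↑E : Set (Sym2 V)))).Reachable a c} *
          (prodBernoulli w).real {ω : Set (Sym2 V) | ¬(openGraph (ω ∩ (↑E : Set (Sym2 V)))).Reachable b c} ≤
      ((prodBernoulli w).real ({ω : Set (Sym2 V) | ¬(openGraph (ω ∩ (↑E : Set (Sym2 V)))).Reachable a c} ∩ {ω : Set (Sym2 V) | ¬(openGraph (ω ∩ (↑E : Set (Sym2 V)))).Reachable b c}) -
          (prodBernoulli w).real ({ω : Set (Sym2 V) | ¬(openGraph (ω ∩ (↑E : Set (Sym2 V)))).Reachable a b} ∩ {ω : Set (Sym2 V) | ¬(openGraph (ω ∩ (↑E : Set (Sym2 V)))).Reachable a c} ∩ {ω : Set (Sym2 V) | ¬(openGraph (ω ∩ (↑E : Set (Sym2 V)))).Reachable b c})) *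
        Real.log ((prodBernoulli w).real {ω : Set (Sym2 V) | (openGraph ((ω ∩ (↑E : Set (Sym2 V))) \ {e : Sym2 V | c ∈ e})).Reachable a b} /
          ((prodBernoulli w).real ({ω : Set (Sym2 V) | ¬(openGraph (ω ∩ (↑E : Set (Sym2 V)))).Reachable a c} ∩ {ω : Set (Sym2 V) | ¬(openGraph (ω ∩ (↑E : Set (Sym2 V)))).Reachable b c}) -
            (prodBernoulli w).real ({ω : Set (Sym2 V) | ¬(openGraph (ω ∩ (↑E : Set (Sym2 V)))).Reachable a b} ∩ {ω : Set (Sym2 V) | ¬(openGraph (ω ∩ (↑E : Set (Sym2 V)))).Reachable a c} ∩ {ω : Set (Sym2 V) | ¬(openGraph (ω ∩ (↑E : Set (Sym2 V)))).Reachable b c}))) :=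
  (sp_facts w h hw).1

omit [Fintype V] in
/-- Covariance is unchanged under complementing both events: `P(Sᶜ ∩ Tᶜ) − P(Sᶜ)P(Tᶜ) = P(S ∩ T) − P(S)P(T)`.
[folklore] -/
theorem cov_compl_eq {Ω : Type*} [MeasurableSpace Ω] (μ : Measure Ω) [IsProbabilityMeasure μ] {S T : Set Ω}
    (hS : MeasurableSet S) (hT : MeasurableSet T) :
    μ.real (Sᶜ ∩ Tᶜ) - μ.real Sᶜ * μ.real Tᶜ = μ.real (S ∩ T) - μ.real S * μ.real T := by
  have h := measureReal_union_add_inter hT (μ := μ) (s := S)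
  rw [← Set.compl_union, probReal_compl_eq_one_sub (hS.union hT), probReal_compl_eq_one_sub hS,
    probReal_compl_eq_one_sub hT, show μ.real (S ∪ T) = μ.real S + μ.real T - μ.real (S ∩ T) by linarith [h]]
  ring

/-- **THEOREM SP, covariance form with modulus `w log (1/w)`** (the form of Gladkov–Zimin Conj. 6.3 / Gladkov Conj. 10.1):
for a two-terminal series–parallel hub network `E` with terminals `a, b`, hub `c` and weights in `(0, 1)`,
`Cov(1{a ↔ c}, 1{b ↔ c}) = P(a ↔ c, b ↔ c) − P(a ↔ c)·P(b ↔ c) ≤ P(ab|c) · log (1 / P(ab|c))`, where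
`P(ab|c) = P(a ↮ c, b ↮ c) − P(a, b, c pairwise separated) = P(a ↔ b, a ↮ c)` (all connections read on `ω ∩ E`).
[folklore; this work — memo THEOREM-SP.md] -/
theorem sp_cov_le_mul_log_inv (w : Sym2 V → unitInterval) {c : V} {E : Finset (Sym2 V)} {a b : V}
    (h : IsSPNet c E a b) (hw : ∀ e ∈ E, 0 < (w e : ℝ) ∧ (w e : ℝ) < 1) :
    (prodBernoulli w).real ({ω : Set (Sym2 V) | (openGraph (ω ∩ (↑E : Set (Sym2 V)))).Reachable a c} ∩ {ω : Set (Sym2 V) | (openGraph (ω ∩ (↑E : Set (Sym2 V)))).Reachable b c}) -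
        (prodBernoulli w).real {ω : Set (Sym2 V) | (openGraph (ω ∩ (↑E : Set (Sym2 V)))).Reachable a c} *
          (prodBernoulli w).real {ω : Set (Sym2 V) | (openGraph (ω ∩ (↑E : Set (Sym2 V)))).Reachable b c} ≤
      ((prodBernoulli w).real ({ω : Set (Sym2 V) | ¬(openGraph (ω ∩ (↑E : Set (Sym2 V)))).Reachable a c} ∩ {ω : Set (Sym2 V) | ¬(openGraph (ω ∩ (↑E : Set (Sym2 V)))).Reachable b c}) -
          (prodBernoulli w).real ({ω : Set (Sym2 V) | ¬(openGraph (ω ∩ (↑E : Set (Sym2 V)))).Reachable a b} ∩ {ω : Set (Sym2 V) | ¬(openGraph (ω ∩ (↑E : Set (Sym2 V)))).Reachable a c} ∩ {ω : Set (Sym2 V) | ¬(openGraph (ω ∩ (↑E : Set (Sym2 V)))).Reachable b c})) *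
        Real.log (1 /
          ((prodBernoulli w).real ({ω : Set (Sym2 V) | ¬(openGraph (ω ∩ (↑E : Set (Sym2 V)))).Reachable a c} ∩ {ω : Set (Sym2 V) | ¬(openGraph (ω ∩ (↑E : Set (Sym2 V)))).Reachable b c}) -
            (prodBernoulli w).real ({ω : Set (Sym2 V) | ¬(openGraph (ω ∩ (↑E : Set (Sym2 V)))).Reachable a b} ∩ {ω : Set (Sym2 V) | ¬(openGraph (ω ∩ (↑E : Set (Sym2 V)))).Reachable a c} ∩ {ω : Set (Sym2 V) | ¬(openGraph (ω ∩ (↑E : Set (Sym2 V)))).Reachable b c}))) := by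
  obtain ⟨L, hn, hnz⟩ := sp_facts w h hw
  have hm : ∀ S : Set (Set (Sym2 V)), MeasurableSet S := fun S => MeasurableSet.of_discrete
  have hcov := cov_compl_eq (prodBernoulli w) (hm {ω : Set (Sym2 V) | (openGraph (ω ∩ (↑E : Set (Sym2 V)))).Reachable a c}) (hm {ω : Set (Sym2 V) | (openGraph (ω ∩ (↑E : Set (Sym2 V)))).Reachable b c})
  simp only [Set.compl_setOf] at hcov
  rw [← hcov]
  refine L.trans (mul_le_mul_of_nonneg_left (Real.log_le_log (div_pos ?_ (by linarith)) ?_) (by linarith))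
  · exact lt_of_lt_of_le (by linarith) (GZGluingLaw.network_facts w (↑E : Set (Sym2 V)) h.terminals_ne.2.1
      rfl rfl rfl rfl).2.2.2.2.2.1
  · exact div_le_div_of_nonneg_right measureReal_le_one (by linarith)

end GZSP

end Summit.CriticalPhenomena.PercolationContinuityZ3.Theorems
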